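import Summits.QuantumFields.BalabanUV.T4Continuum.Support.VariationalRegularityFibre

/-!
# T⁴ programme, spine node NE2 (U1a), lane P2 — LEAF L0-REG of the variational route PROVED (part 2): the L²-REGULARITY OF
# BAŁABAN'S MINIMISER `Σ_{x,μ,ν,κ}|F^{(η)}[H_kB](x+e_κ) − F^{(η)}[H_kB](x)|² ≤ (4d/γ₀)·n⁻²·Σ|F^{(η)}[H_kB]|²`,
# γ₀ = (4/π²)^{d+2}, EVERY n ≥ 1, every torus, every B — and tier 0 of row NE2 along the variational route with NO hypothesis
# (`t4/skeletons/NE2-t4-ne2-p2.md` §2; cell `pub-balaban`, row NE2 co-owner #2, lineage t4-ne2-p2 gen 9)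

HONEST FRAMING (T4-DAG p. 1): rung (B)+1 only — NOT infinite volume, NOT a mass gap, NOT Clay.  `U = 1` Fourier algebra on the
torus about Bałaban's (1.63) minimiser; the η-rate printed at the end (`effAction_rate`) is the `U = 1` effective-action species of
row NE2 ONLY (its conclusion is also a tree theorem by the Fourier route, `T4GaugeActionRate`); nothing printed is a hypothesis.
PRINTED MODEL (text location only): [Balaban1984PropagatorsI] pp. 28–29 «Another important property is that the sum over l of
the absolute value of this expression multiplied by |∂_ν(p′+l)||p′+l|^α is bounded by a constant dependent on d only» (SUP-norm
Hölder, α < 1); the L² statement with the full power proved here is NOT printed.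

MECHANISM ([folklore]; part 1 = `VariationalRegularityFibre`): on the fibre `p = p′ + l` the alias-`l` energy density of the
minimiser is `c⁻²|u|²Σ_κ|v_κ|²|w_κ|²/Δ(p′+l)` with `w` independent of `l`; the weight `Δ^{fine}(p′+l) = Δ(p′+l)/n²` CANCELS the
propagator, and `Σ_l |u v_κ|² ≤ Σ_l |u|² = 1` (E4) against `Σ_l |u v_κ|²/Δ(p′+l) = φ_κ ≥ γ₀/Δ₀ ≥ γ₀/(4d)` ((1.62), tree
`Delta0_phi162_lower`): weighted ≤ (4d/γ₀)·n⁻²·unweighted per fibre (`perfibre_le`), then the weighted Plancherel of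
`VariationalPlancherel.sum_Delta0_curlHat` and the reindexing `p = pOf (l, p′)` assemble the leaf (`minimiserRegularityL2_holds`).
-/

noncomputable section

namespace Summit.QuantumFields.BalabanUV.T4Continuum.VariationalRegularity

open scoped Matrix ComplexConjugate BigOperators
open Complex
open Summit.QuantumFields.BalabanUV.T4Continuum.VariationalPlancherel
open Summit.QuantumFields.BalabanUV.T4Continuum.VariationalRegularityFibre
open Literature.MathematicalPhysics.QuantumFieldTheory.Balaban1983to89

/-! ## §3 The curl energy density on the fibre and the per-fibre inequality -/

section perfibre

open Literature.MathematicalPhysics.QuantumFieldTheory.Balaban1983to89.B5Prop11Plancherel (Tor fine unitVec sOf dft dftV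
  abs_sOf_le sOf_ne_zero)
open Literature.MathematicalPhysics.QuantumFieldTheory.Balaban1983to89.B5Prop11Fiber (dSym d1Sym norm_d1Sym_sq Delta_eq)
open Literature.MathematicalPhysics.QuantumFieldTheory.Balaban1983to89.B5Block118 (pOf cQ pOf_bijective)
open Literature.MathematicalPhysics.QuantumFieldTheory.Balaban1983to89.B5Hk163Torus (HkOp)
open Literature.MathematicalPhysics.QuantumFieldTheory.Balaban1983to89.B5Hk163RDiv (wT)
open Literature.MathematicalPhysics.QuantumFieldTheory.Balaban1983to89.B4Strip (Delta1r S1r DeltaXir shiftr Ur uFactorr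
  Ur_nonneg uFactorr_nonneg)
open Literature.MathematicalPhysics.QuantumFieldTheory.Balaban1983to89.B5Prop11Leaves (uFactorr_le_one sum_Ur_eq_one
  Delta1r_pos Delta1r_le Delta1r_le_DeltaXir_shift)
open Literature.MathematicalPhysics.QuantumFieldTheory.Balaban1983to89.B5Bounds167Lattice (phi162 phi162_eq Delta0_phi162_lower
  curl curlHat hat fsym_one)
open Literature.MathematicalPhysics.QuantumFieldTheory.Balaban1983to89.B5Momentum133 (ssym_pOf)
open Literature.MathematicalPhysics.QuantumFieldTheory.Balaban1983to89.T4GaugeActionRate (gam0 gam0_pos)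

variable {d : ℕ} (n : ℕ) [NeZero n] (M : Fin d → ℕ) [hM : ∀ μ, NeZero (M μ)]

/-- the unit forward-difference symbol of the FINE torus at `p = pOf (k, q)` is `∂(p′+l)/n`. [folklore] -/
theorem d1Sym_sOf_pOf (k : Fin d → Fin n) (q : Tor M) (μ : Fin d) :
    d1Sym (sOf (fine n M) (pOf n M (k, q))) μ = dSym n k (sOf M q) μ / (n : ℂ) := by
  have hn : (n : ℂ) ≠ 0 := by exact_mod_cast NeZero.ne n
  rw [← fsym_one (fine n M) (pOf n M (k, q)) μ μ, ← ssym_pOf n M k q μ]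
  simp only [B5Prop11Plancherel.fsym, B5LaplaceInverse.ssym]
  field_simp

/-- the weight: `Δ₀^{fine}(p) = Δ(p′+l)/n²` at `p = pOf (k, q)`. [folklore] -/
theorem Delta1r_sOf_pOf (k : Fin d → Fin n) (q : Tor M) :
    Delta1r 0 (sOf (fine n M) (pOf n M (k, q))) = DeltaXir n 0 (shiftr n k (sOf M q)) / (n : ℝ) ^ 2 := by
  unfold Delta1r
  rw [add_zero, Delta_eq, Finset.sum_div]
  refine Finset.sum_congr rfl fun μ _ => ?_
  rw [← norm_d1Sym_sq, d1Sym_sOf_pOf, norm_div, div_pow, Complex.norm_natCast]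

/-- the curl density of the minimiser on the fibre: `½Σ_{μ,ν}|(∂₁H_kB)~_{μν}(p′+l)|² = (Ĥ†Ĝ).re / n²`
(Lagrange identity + `d1Sym_sOf_pOf`). [folklore] -/
theorem curl_density_eq (B : Tor M × Fin d → ℂ) (k : Fin d → Fin n) (q : Tor M) :
    (1 / 2 : ℝ) * ∑ μ, ∑ ν, ‖curlHat (fine n M) (HkOp n M *ᵥ B) μ ν (pOf n M (k, q))‖ ^ 2
      = (star (Hh n M B k q) ⬝ᵥ Gh n M B k q).re / (n : ℝ) ^ 2 := by
  have hn : (n : ℂ) ≠ 0 := by exact_mod_cast NeZero.ne n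
  have hcomp : ∀ ν, hat (fine n M) (HkOp n M *ᵥ B) ν (pOf n M (k, q)) = Hh n M B k q ν := fun ν => rfl
  have hc : ∀ μ ν, curlHat (fine n M) (HkOp n M *ᵥ B) μ ν (pOf n M (k, q))
      = (dS n M k q μ * Hh n M B k q ν - dS n M k q ν * Hh n M B k q μ) / (n : ℂ) := by
    intro μ ν
    show d1Sym (sOf (fine n M) (pOf n M (k, q))) μ * hat (fine n M) (HkOp n M *ᵥ B) ν (pOf n M (k, q))
        - d1Sym (sOf (fine n M) (pOf n M (k, q))) ν * hat (fine n M) (HkOp n M *ᵥ B) μ (pOf n M (k, q)) = _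
    rw [hcomp, hcomp, d1Sym_sOf_pOf, d1Sym_sOf_pOf]
    simp only [dS]
    field_simp
  simp_rw [hc, norm_div, div_pow, Complex.norm_natCast, ← Finset.sum_div]
  rw [energy_density_eq]
  have hL := lagrange_one (dS n M k q) (Hh n M B k q)
  have hre : (((∑ μ, ∑ ν, ‖dS n M k q μ * Hh n M B k q ν - dS n M k q ν * Hh n M B k q μ‖ ^ 2 : ℝ)) : ℂ)
      = ∑ μ, ∑ ν, conj (dS n M k q μ * Hh n M B k q ν - dS n M k q ν * Hh n M B k q μ)
          * (dS n M k q μ * Hh n M B k q ν - dS n M k q ν * Hh n M B k q μ) := by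
    simp only [Complex.ofReal_sum, Complex.ofReal_pow, Complex.conj_mul']
  have hstar : star (star (dS n M k q) ⬝ᵥ Hh n M B k q) = ∑ nu, dS n M k q nu * conj (Hh n M B k q nu) := by
    rw [← Matrix.star_dotProduct (Hh n M B k q) (dS n M k q)]
    simp only [dotProduct, Pi.star_apply, Complex.star_def, mul_comm]
  have key : (star (dS n M k q) ⬝ᵥ dS n M k q) * (star (Hh n M B k q) ⬝ᵥ Hh n M B k q)
      - (star (dS n M k q) ⬝ᵥ Hh n M B k q) * star (star (dS n M k q) ⬝ᵥ Hh n M B k q)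
      = ((((1 / 2 : ℝ) * ∑ μ, ∑ ν, ‖dS n M k q μ * Hh n M B k q ν - dS n M k q ν * Hh n M B k q μ‖ ^ 2 : ℝ)) : ℂ) := by
    rw [Complex.ofReal_mul, hre]
    push_cast
    rw [← hL, hstar]
    simp only [dotProduct, Pi.star_apply, Complex.star_def]
  rw [key, Complex.ofReal_re]
  ring

/-- **THE PER-FIBRE INEQUALITY** (fixed coarse class `q`, summed over the `n^d` aliases `k`): the `Δ₀^{fine}`-weighted curl
energy of the minimiser is at most `(4d/γ₀)·n⁻²` times the unweighted one. [folklore] -/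
theorem perfibre_le (B : Tor M × Fin d → ℂ) (q : Tor M) :
    ∑ k : Fin d → Fin n, Delta1r 0 (sOf (fine n M) (pOf n M (k, q)))
        * ((1 / 2 : ℝ) * ∑ μ, ∑ ν, ‖curlHat (fine n M) (HkOp n M *ᵥ B) μ ν (pOf n M (k, q))‖ ^ 2)
      ≤ 4 * d / gam0 d / (n : ℝ) ^ 2 *
        ∑ k : Fin d → Fin n, (1 / 2 : ℝ) * ∑ μ, ∑ ν, ‖curlHat (fine n M) (HkOp n M *ᵥ B) μ ν (pOf n M (k, q))‖ ^ 2 := by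
  have hn : 1 ≤ n := Nat.one_le_iff_ne_zero.mpr (NeZero.ne n)
  have hnr : (0 : ℝ) < n := by exact_mod_cast Nat.pos_of_ne_zero (NeZero.ne n)
  have hγ := gam0_pos d
  simp_rw [curl_density_eq, Delta1r_sOf_pOf]
  -- weighted term = |Ĝ|²/n⁴
  have hW : ∀ k, DeltaXir n 0 (shiftr n k (sOf M q)) / (n : ℝ) ^ 2 * ((star (Hh n M B k q) ⬝ᵥ Gh n M B k q).re / (n : ℝ) ^ 2)
      = (∑ c, ‖Gh n M B k q c‖ ^ 2) / (n : ℝ) ^ 4 := by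
    intro k; rw [← Delta_mul_density_eq]; field_simp
  simp_rw [hW, ← Finset.sum_div]
  by_cases hq : q = 0
  · subst hq
    simp [Gh_zero]
  -- q ≠ 0: explicit alias sums
  have hs : ∀ ν, |sOf M q ν| ≤ Real.pi := abs_sOf_le M q
  obtain ⟨ν₀, hν₀⟩ := Function.ne_iff.mp (sOf_ne_zero M hq)
  set s := sOf M q with hsdef
  set wv : Fin d → ℂ := fun c => wT n s (fun lam => (dft M *ᵥ B5Action121.comp M B lam) q) c with hwv
  set C2 : ℝ := ‖((cQ n M : ℂ))⁻¹‖ ^ 2 with hC2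
  have hC2nn : 0 ≤ C2 := by positivity
  set a : (Fin d → Fin n) → ℝ := fun k => Ur n k s * ∑ c, uFactorr n (k c : ℕ) (s c) * ‖wv c‖ ^ 2 with ha
  have hG : ∀ k, ∑ c, ‖Gh n M B k q c‖ ^ 2 = C2 * a k := fun k => sum_normSq_Gh_of_ne n M B k hq
  have hΔpos : ∀ k, 0 < DeltaXir n 0 (shiftr n k s) := fun k =>
    (Delta1r_pos s hs ν₀ hν₀).trans_le (Delta1r_le_DeltaXir_shift n hn k s)
  have he : ∀ k, (star (Hh n M B k q) ⬝ᵥ Gh n M B k q).re = C2 * a k / DeltaXir n 0 (shiftr n k s) := by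
    intro k
    rw [eq_div_iff (hΔpos k).ne', mul_comm]
    have := Delta_mul_density_eq n M B k q
    rw [hG k] at this
    exact this
  simp_rw [he]
  -- Σ_k a_k ≤ Σ_c |w_c|²
  have hsum_a : ∑ k, a k ≤ ∑ c, ‖wv c‖ ^ 2 := by
    have h1 : ∑ k, a k = ∑ c, ‖wv c‖ ^ 2 * ∑ k, Ur n k s * uFactorr n (k c : ℕ) (s c) := by
      calc ∑ k, a k = ∑ k, ∑ c, Ur n k s * (uFactorr n (k c : ℕ) (s c) * ‖wv c‖ ^ 2) := by
            refine Finset.sum_congr rfl fun k _ => ?_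
            simp only [ha]
            rw [Finset.mul_sum]
        _ = ∑ c, ∑ k, Ur n k s * (uFactorr n (k c : ℕ) (s c) * ‖wv c‖ ^ 2) := Finset.sum_comm
        _ = ∑ c, ‖wv c‖ ^ 2 * ∑ k, Ur n k s * uFactorr n (k c : ℕ) (s c) := by
            refine Finset.sum_congr rfl fun c _ => ?_
            rw [Finset.mul_sum]
            exact Finset.sum_congr rfl fun k _ => by ring
    rw [h1]
    refine Finset.sum_le_sum fun c _ => ?_
    have h2 : ∑ k, Ur n k s * uFactorr n (k c : ℕ) (s c) ≤ 1 := by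
      calc ∑ k, Ur n k s * uFactorr n (k c : ℕ) (s c) ≤ ∑ k, Ur n k s := Finset.sum_le_sum fun k _ =>
            mul_le_of_le_one_right (Ur_nonneg _ _ _) (uFactorr_le_one n hn _ _)
        _ = 1 := sum_Ur_eq_one n hn s hs
    calc ‖wv c‖ ^ 2 * ∑ k, Ur n k s * uFactorr n (k c : ℕ) (s c) ≤ ‖wv c‖ ^ 2 * 1 :=
          mul_le_mul_of_nonneg_left h2 (by positivity)
      _ = ‖wv c‖ ^ 2 := mul_one _
  -- Σ_k a_k/Δ_k = Σ_c |w_c|² φ_c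
  have hsum_e : ∑ k, a k / DeltaXir n 0 (shiftr n k s) = ∑ c, ‖wv c‖ ^ 2 * phi162 n c s := by
    calc ∑ k, a k / DeltaXir n 0 (shiftr n k s)
        = ∑ k, ∑ c, ‖wv c‖ ^ 2 * (Ur n k s * uFactorr n (k c : ℕ) (s c) / DeltaXir n 0 (shiftr n k s)) := by
          refine Finset.sum_congr rfl fun k _ => ?_
          simp only [ha]
          rw [Finset.mul_sum, Finset.sum_div]
          exact Finset.sum_congr rfl fun c _ => by ring
      _ = ∑ c, ∑ k, ‖wv c‖ ^ 2 * (Ur n k s * uFactorr n (k c : ℕ) (s c) / DeltaXir n 0 (shiftr n k s)) := Finset.sum_comm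
      _ = ∑ c, ‖wv c‖ ^ 2 * phi162 n c s := by
          refine Finset.sum_congr rfl fun c _ => ?_
          rw [phi162_eq n hn c s hs, Finset.mul_sum]
  -- φ_c ≥ γ₀/Δ₀
  have hΔ0pos : 0 < Delta1r 0 s := Delta1r_pos s hs ν₀ hν₀
  have hΔ0le : Delta1r 0 s ≤ 4 * d := Delta1r_le s
  have hφ : ∀ c, gam0 d / Delta1r 0 s ≤ phi162 n c s := by
    intro c
    rw [div_le_iff₀ hΔ0pos, mul_comm]
    exact Delta0_phi162_lower n hn c s hs ν₀ hν₀
  have hlow : gam0 d / Delta1r 0 s * ∑ c, ‖wv c‖ ^ 2 ≤ ∑ c, ‖wv c‖ ^ 2 * phi162 n c s := by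
    rw [Finset.mul_sum]
    refine Finset.sum_le_sum fun c _ => ?_
    rw [mul_comm]
    exact mul_le_mul_of_nonneg_left (hφ c) (by positivity)
  -- main chain
  have hmain : ∑ k, C2 * a k ≤ 4 * d / gam0 d * ∑ k, C2 * a k / DeltaXir n 0 (shiftr n k s) := by
    have e1 : ∑ k, C2 * a k = C2 * ∑ k, a k := by rw [Finset.mul_sum]
    have e2 : ∑ k, C2 * a k / DeltaXir n 0 (shiftr n k s) = C2 * ∑ k, a k / DeltaXir n 0 (shiftr n k s) := by
      rw [Finset.mul_sum]; exact Finset.sum_congr rfl fun k _ => by ring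
    rw [e1, e2, hsum_e]
    have hstep : ∑ c, ‖wv c‖ ^ 2 ≤ 4 * d / gam0 d * ∑ c, ‖wv c‖ ^ 2 * phi162 n c s := by
      have h3 : ∑ c, ‖wv c‖ ^ 2 = Delta1r 0 s / gam0 d * (gam0 d / Delta1r 0 s * ∑ c, ‖wv c‖ ^ 2) := by
        rw [← mul_assoc, show Delta1r 0 s / gam0 d * (gam0 d / Delta1r 0 s) = 1 by field_simp, one_mul]
      rw [h3]
      have h4 : Delta1r 0 s / gam0 d ≤ 4 * d / gam0 d := div_le_div_of_nonneg_right hΔ0le hγ.le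
      have hnn : 0 ≤ ∑ c, ‖wv c‖ ^ 2 * phi162 n c s :=
        Finset.sum_nonneg fun c _ => mul_nonneg (by positivity) (le_trans (by positivity) (hφ c))
      calc Delta1r 0 s / gam0 d * (gam0 d / Delta1r 0 s * ∑ c, ‖wv c‖ ^ 2)
          ≤ Delta1r 0 s / gam0 d * (∑ c, ‖wv c‖ ^ 2 * phi162 n c s) := mul_le_mul_of_nonneg_left hlow (by positivity)
        _ ≤ 4 * d / gam0 d * (∑ c, ‖wv c‖ ^ 2 * phi162 n c s) := mul_le_mul_of_nonneg_right h4 hnn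
    calc C2 * ∑ k, a k ≤ C2 * ∑ c, ‖wv c‖ ^ 2 := mul_le_mul_of_nonneg_left hsum_a hC2nn
      _ ≤ C2 * (4 * d / gam0 d * ∑ c, ‖wv c‖ ^ 2 * phi162 n c s) := mul_le_mul_of_nonneg_left hstep hC2nn
      _ = 4 * d / gam0 d * (C2 * ∑ c, ‖wv c‖ ^ 2 * phi162 n c s) := by ring
  simp_rw [hG]
  have hn4 : (0 : ℝ) < (n : ℝ) ^ 4 := by positivity
  calc (∑ k, C2 * a k) / (n : ℝ) ^ 4
      ≤ (4 * d / gam0 d * ∑ k, C2 * a k / DeltaXir n 0 (shiftr n k s)) / (n : ℝ) ^ 4 :=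
        div_le_div_of_nonneg_right hmain hn4.le
    _ = 4 * d / gam0 d / (n : ℝ) ^ 2 * ((∑ k, C2 * a k / DeltaXir n 0 (shiftr n k s)) / (n : ℝ) ^ 2) := by
        field_simp

end perfibre

/-! ## §4 Global assembly: the leaf `MinimiserRegularityL2 d (4d/γ₀)` -/

section assembly

open Literature.MathematicalPhysics.QuantumFieldTheory.Balaban1983to89.B5Prop11Plancherel (Tor fine unitVec sOf dft)
open Literature.MathematicalPhysics.QuantumFieldTheory.Balaban1983to89.B5Block118 (pOf pOf_bijective)
open Literature.MathematicalPhysics.QuantumFieldTheory.Balaban1983to89.B5Hk163Torus (HkOp)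
open Literature.MathematicalPhysics.QuantumFieldTheory.Balaban1983to89.B5Action121 (Fs)
open Literature.MathematicalPhysics.QuantumFieldTheory.Balaban1983to89.B4Strip (Delta1r)
open Literature.MathematicalPhysics.QuantumFieldTheory.Balaban1983to89.B5Bounds167Lattice (curl curlHat hat_curl
  sum_norm_sq_dft)
open Literature.MathematicalPhysics.QuantumFieldTheory.Balaban1983to89.T4GaugeActionRate (gam0 gam0_pos)
open Summit.QuantumFields.BalabanUV.T4Continuum.VariationalLeaves (MinimiserRegularityL2)

/-- reindexing a real sum over fine momenta by the bijection `(l, p′) ↦ p′ + l`, fibre by fibre: `Σ_p g p = Σ_{q} Σ_{k} g (pOf (k,q))`.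
[folklore] -/
theorem sum_fine_eq_sum_fibre {d : ℕ} (n : ℕ) [NeZero n] (M : Fin d → ℕ) [∀ μ, NeZero (M μ)] (g : Tor (fine n M) → ℝ) :
    ∑ p, g p = ∑ q : Tor M, ∑ k : Fin d → Fin n, g (pOf n M (k, q)) := by
  rw [← (pOf_bijective n M).sum_comp g, Fintype.sum_prod_type, Finset.sum_comm]

/-- **LEAF L0-REG PROVED**: the L²-regularity of Bałaban's minimiser `H_kB` with the explicit constant `C_reg = 4d/γ₀`,
`γ₀ = (4/π²)^{d+2}`: `Σ_{x,μ,ν,λ}|F_{μν}(x+e_λ) − F_{μν}(x)|² ≤ (4d/γ₀)·n⁻²·Σ_{x,μ,ν}|F_{μν}(x)|²` at `A = H_kB`, for every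
`n ≥ 1`, every torus and every `B` (B5 (1.63)/(1.67) in L² form; proof: Plancherel on the η-lattice, the fibre
Euler–Lagrange identity `Ĝ = Δ•Ĥ − (∂̄·Ĥ)∂` of §2 and the per-fibre inequality `perfibre_le` of §3). [folklore] -/
theorem minimiserRegularityL2_holds (d : ℕ) : MinimiserRegularityL2 d (4 * d / gam0 d) := by
  intro n _ M _ B
  have hn : (0 : ℝ) < (n : ℝ) := by exact_mod_cast Nat.pos_of_ne_zero (NeZero.ne n)
  have hn2 : (0 : ℝ) < (n : ℝ) ^ 2 := by positivity
  have hK : 0 ≤ 4 * (d : ℝ) / gam0 d / (n : ℝ) ^ 2 := by have := gam0_pos d; positivity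
  -- `F = n·curl`: both sides carry the factor `n²`
  simp_rw [Fs_eq_mul_curl, ← mul_sub, norm_mul, Complex.norm_natCast, mul_pow, ← Finset.mul_sum]
  rw [show 4 * (d : ℝ) / gam0 d / (n : ℝ) ^ 2 * ((n : ℝ) ^ 2 * ∑ x : Tor (fine n M), ∑ μ : Fin d, ∑ ν : Fin d,
      ‖curl (fine n M) (HkOp n M *ᵥ B) μ ν x‖ ^ 2) = (n : ℝ) ^ 2 * (4 * (d : ℝ) / gam0 d / (n : ℝ) ^ 2 *
      ∑ x : Tor (fine n M), ∑ μ : Fin d, ∑ ν : Fin d, ‖curl (fine n M) (HkOp n M *ᵥ B) μ ν x‖ ^ 2) by ring]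
  refine mul_le_mul_of_nonneg_left ?_ hn2.le
  -- LHS in momentum space, fibrewise: `Σ_q Σ_k Δ₀(pOf(k,q)) Σ_μ Σ_ν |curlHat(pOf(k,q))|²`
  have hL : (∑ x : Tor (fine n M), ∑ μ : Fin d, ∑ ν : Fin d, ∑ κ : Fin d,
        ‖curl (fine n M) (HkOp n M *ᵥ B) μ ν (x + unitVec (fine n M) κ) - curl (fine n M) (HkOp n M *ᵥ B) μ ν x‖ ^ 2)
      = ∑ q : Tor M, ∑ k : Fin d → Fin n, Delta1r 0 (sOf (fine n M) (pOf n M (k, q)))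
          * ∑ μ : Fin d, ∑ ν : Fin d, ‖curlHat (fine n M) (HkOp n M *ᵥ B) μ ν (pOf n M (k, q))‖ ^ 2 := by
    rw [sum4_comm]
    have h1 : (∑ μ : Fin d, ∑ ν : Fin d, ∑ κ : Fin d, ∑ x : Tor (fine n M),
          ‖curl (fine n M) (HkOp n M *ᵥ B) μ ν (x + unitVec (fine n M) κ) - curl (fine n M) (HkOp n M *ᵥ B) μ ν x‖ ^ 2)
        = ∑ μ : Fin d, ∑ ν : Fin d, ∑ p : Tor (fine n M),
            Delta1r 0 (sOf (fine n M) p) * ‖curlHat (fine n M) (HkOp n M *ᵥ B) μ ν p‖ ^ 2 :=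
      Finset.sum_congr rfl fun μ _ => Finset.sum_congr rfl fun ν _ => (sum_Delta0_curlHat (HkOp n M *ᵥ B) μ ν).symm
    rw [h1, ← sum3_comm (fun (p : Tor (fine n M)) (μ : Fin d) (ν : Fin d) =>
      Delta1r 0 (sOf (fine n M) p) * ‖curlHat (fine n M) (HkOp n M *ᵥ B) μ ν p‖ ^ 2), sum_fine_eq_sum_fibre n M]
    simp_rw [Finset.mul_sum]
  -- RHS in momentum space, fibrewise: `Σ_q Σ_k Σ_μ Σ_ν |curlHat(pOf(k,q))|²`
  have hR : (∑ x : Tor (fine n M), ∑ μ : Fin d, ∑ ν : Fin d, ‖curl (fine n M) (HkOp n M *ᵥ B) μ ν x‖ ^ 2)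
      = ∑ q : Tor M, ∑ k : Fin d → Fin n, ∑ μ : Fin d, ∑ ν : Fin d,
          ‖curlHat (fine n M) (HkOp n M *ᵥ B) μ ν (pOf n M (k, q))‖ ^ 2 := by
    rw [sum3_comm]
    have h1 : (∑ μ : Fin d, ∑ ν : Fin d, ∑ x : Tor (fine n M), ‖curl (fine n M) (HkOp n M *ᵥ B) μ ν x‖ ^ 2)
        = ∑ μ : Fin d, ∑ ν : Fin d, ∑ p : Tor (fine n M), ‖curlHat (fine n M) (HkOp n M *ᵥ B) μ ν p‖ ^ 2 := by
      refine Finset.sum_congr rfl fun μ _ => Finset.sum_congr rfl fun ν _ => ?_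
      rw [← sum_norm_sq_dft]
      simp_rw [hat_curl]
    rw [h1, ← sum3_comm (fun (p : Tor (fine n M)) (μ : Fin d) (ν : Fin d) =>
      ‖curlHat (fine n M) (HkOp n M *ᵥ B) μ ν p‖ ^ 2), sum_fine_eq_sum_fibre n M]
  rw [hL, hR, Finset.mul_sum]
  refine Finset.sum_le_sum fun q _ => ?_
  -- the per-fibre inequality of §3 (stated with the `½Σ_{μ,ν}` normalisation)
  have h := perfibre_le n M B q
  have s1 : (∑ k : Fin d → Fin n, Delta1r 0 (sOf (fine n M) (pOf n M (k, q)))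
        * ∑ μ : Fin d, ∑ ν : Fin d, ‖curlHat (fine n M) (HkOp n M *ᵥ B) μ ν (pOf n M (k, q))‖ ^ 2)
      = 2 * ∑ k : Fin d → Fin n, Delta1r 0 (sOf (fine n M) (pOf n M (k, q)))
        * ((1 / 2 : ℝ) * ∑ μ : Fin d, ∑ ν : Fin d, ‖curlHat (fine n M) (HkOp n M *ᵥ B) μ ν (pOf n M (k, q))‖ ^ 2) := by
    rw [Finset.mul_sum]; exact Finset.sum_congr rfl fun k _ => by ring
  have s2 : (∑ k : Fin d → Fin n, ∑ μ : Fin d, ∑ ν : Fin d, ‖curlHat (fine n M) (HkOp n M *ᵥ B) μ ν (pOf n M (k, q))‖ ^ 2)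
      = 2 * ∑ k : Fin d → Fin n,
          ((1 / 2 : ℝ) * ∑ μ : Fin d, ∑ ν : Fin d, ‖curlHat (fine n M) (HkOp n M *ᵥ B) μ ν (pOf n M (k, q))‖ ^ 2) := by
    rw [Finset.mul_sum]; exact Finset.sum_congr rfl fun k _ => by ring
  rw [s1, s2, mul_left_comm]
  exact mul_le_mul_of_nonneg_left h (by norm_num)

/-- **L0-CONS UNCONDITIONAL**: the one-step consistency on Bałaban's minimiser, for every block side `L ≥ 1`, with the explicit
constant `3γ₀⁻⁶(π⁴/32)·(4d/γ₀)`. [folklore] -/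
theorem oneStepConsistency_holds {d : ℕ} (L : ℕ) [NeZero L] (hL : 1 ≤ L) :
    VariationalLeaves.OneStepConsistency d L (3 / gam0 d ^ 6 * (Real.pi ^ 4 / 32) * (4 * d / gam0 d)) :=
  oneStepConsistency_of_regularity L (minimiserRegularityL2_holds d) hL

/-- **TIER 0 OF ROW NE2 ALONG THE VARIATIONAL ROUTE, UNCONDITIONAL, IN KING'S SHAPE**: for every block side `L ≥ 1`, every
level `k`, every unit torus `M` and every `B`,
`0 ≤ Δ_{k+1}(B) − Δ_k(B) ≤ 3γ₀⁻⁶(π⁴/32)(4d/γ₀)·(L⁻²)^k·Δ_k(B)` — the η-rate `η_k² = L^{−2k}` of Bałaban's `U = 1`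
effective actions, with NO hypothesis. [folklore] -/
theorem effAction_rate {d : ℕ} (L : ℕ) [NeZero L] (hL : 1 ≤ L) (k : ℕ) (M : Fin d → ℕ) [∀ μ, NeZero (M μ)]
    (B : Tor M × Fin d → ℂ) :
    haveI : NeZero (L ^ k) := ⟨pow_ne_zero k (NeZero.ne L)⟩
    0 ≤ VariationalTransfer.effActionSucc (L ^ k) L M B - VariationalTransfer.effAction (L ^ k) M B ∧
      VariationalTransfer.effActionSucc (L ^ k) L M B - VariationalTransfer.effAction (L ^ k) M B
        ≤ 3 / gam0 d ^ 6 * (Real.pi ^ 4 / 32) * (4 * d / gam0 d) * (((L : ℝ) ^ 2)⁻¹) ^ k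
          * VariationalTransfer.effAction (L ^ k) M B :=
  effAction_rate_of_regularity L M (minimiserRegularityL2_holds d) hL k B

end assembly

end Summit.QuantumFields.BalabanUV.T4Continuum.VariationalRegularity
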